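import Summits.Langlands.Langlands.Theses.OrdinaryPrimeTransport
import Summits.Langlands.Langlands.Theorems.BaseFieldAscentReciprocityTRCMPotentialAutomorphyCMTightness
import Literature.NumberTheory.DiophantineGeometry.BcgpResiduallyA5bModular
import Literature.NumberTheory.Automorphic.IsAutomorphicAE
import HarnessLib

/-!
# Line `AbelianThreefoldPotentialAutomorphy` — crux `ReciprocityUpToIrreducibility` (item stmt-Langlands-14328; routes
`IrreducibilityBySelfDuality` (primary decl) and `OrdinaryPrimeTransport` (its `Iff.rfl`-equal copy)); G4 ladder-down generation 31

DIAL θ31 = the GENUS / DIMENSION `g = dim A` of ABELIAN VARIETIES over TOTALLY REAL fields, inside clause (B) at `n = 2g`: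
POTENTIAL automorphy of the framed dual `r` of `V_ℓ(A)` (the compatible system `H¹_ét(A) ⊗ ℚ̄_ℓ`, Hodge–Tate weights `0, 1`
each with multiplicity `g`).  Family `PotentiallyAutomorphicAbelianVarietyTR g`: for every totally real `K`, every
`A : AbelianVariety K` with `A.dim = g`, every prime `ℓ`, `ℚ_ℓ`-basis `b` of `V_ℓ(A)` and framed dual `r : Γ_K → GL_{2g}(ℚ̄_ℓ)`
(`IsFramedDualTate`, verbatim the BCGP clause `r(γ) = [γ⁻¹]_bᵀ`) which is IRREDUCIBLE, a.e. unramified and de Rham above `ℓ`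
for Fontaine's pinned datum, and every `ι`, the representation `r` is POTENTIALLY AUTOMORPHIC (`IsPotentiallyAutomorphic`):
there are a finite Galois extension `L/K` and an `L`-algebraic automorphic `P` on `GL_{2g}(𝔸_L)` whose Satake parameters match
`r|_{Γ_L}` at almost all places (BCGP 2021 Def. 9.1.1 / §9.1 read in the summit's a.e. vocabulary `SatakeFrobCompatibleAt`).
* `g = 1`: elliptic curves over totally real fields are potentially modular (Taylor 2002/2006; implied in AV form by nothing
  in the tree — not used here);
* `g = 2` = THE FLOOR: Boxer–Calegari–Gee–Pilloni 2021, Thm. 1.1.3 ("abelian surfaces over totally real fields are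
  potentially automorphic"), vendored by this unit as the named fact
  `Literature.NumberTheory.Automorphic.bcgp2021_potentiallyAutomorphic_abelianSurface` (p214362; `FloorText` below is its
  body VERBATIM) ⇒ `floor_two` (sorry-free: the two renderings agree up to unfolding `SatakeFrobCompatibleAt`);
* `g = 3` = THE RUNG `AbelianThreefoldPotentialAutomorphy` — OPEN, with the located stop printed by the floor's authors
  (BCGP §1.4.1, arXiv text p. 10: for `g ≥ 3` the expected `π_∞` on `SO(2g-1,2)` is neither discrete series nor a
  non-degenerate limit, "so the automorphic representations do not contribute to the cohomology (of any kind) of the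
  corresponding Shimura variety … even proving the modularity of a single such curve with Mumford–Tate group `GSp_{2g}` seems
  completely out of reach"; Calegari 2021 survey §12: "curves of genus `g > 2` whose Jacobians have no extra endomorphisms
  seems equally hopeless", tetrachotomy footnote: the "fourth form … a complete mystery");
* `g ≥ 4` = `HigherGenusPotentialAutomorphy`.
Skeleton: five registered stubs over five NAMED obligation nodes (`FloorText`, `AbelianThreefoldPotentialAutomorphy`,
`HigherGenusPotentialAutomorphy`, `SectorMergeStep`, `OffSectorReciprocity`): `stub_floorFact`, `stub_rung`, `stub_higher`,
`stub_sectorMerge`, `stub_offSector`; the composition `ReciprocityUpToIrreducibility_of` concludes the crux decl BY NAME —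
in this PUBLISHED copy through its `Iff.rfl`-equal copy `Summit.Langlands.Langlands.Theses.OrdinaryPrimeTransport.ReciprocityUpToIrreducibility`
(the crux-workfile farm path answers `remote:incoherent … IrreducibilityBySelfDuality: mismatch`, as for g25–g27; the seat's
registration copy `line-AbelianThreefoldPotentialAutomorphy.lean` imports both route modules and concludes the primary decl
`…IrreducibilityBySelfDuality.ReciprocityUpToIrreducibility`, `lean check` rc 0 on the build farm) with no `sorry` outside the stubs — `by_cases` on the
sector `InAbelianVarietyTRSector` exactly as the lines `GL2TypeSurfaceRealQuadratic` / `A5bTwoRankOne` / `AsaiGL3`.  On-path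
(`Langlands → rung`, `E → rung`) in §6 and in `Lines/AbelianThreefoldPotentialAutomorphy_onpath.lean` (witness `L := K`,
`IsGalois.self`, the landed `Theorems.ReciprocityTRCM.satakeFrobCompatibleAt_restrictField_self`); F3 witness in
`Lines/AbelianThreefoldPotentialAutomorphy_special.lean`; card `Lines/AbelianThreefoldPotentialAutomorphy.md`; ladder
`LADDER-AbelianThreefoldPotentialAutomorphy.md`.
-/

noncomputable section

set_option linter.dupNamespace false

open scoped MatrixGroups Matrix NumberField Classical
open Filter IsDedekindDomain IsDedekindDomain.HeightOneSpectrum CategoryTheory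
open Literature.NumberTheory.Automorphic Literature.NumberTheory.GaloisRepresentations
open Literature.NumberTheory.PAdicHodge Literature.NumberTheory.DiophantineGeometry
open Literature.AlgebraicGeometry.Motives (AbelianVariety)
open NumberField
open Summit.Langlands

namespace Summit.Langlands.Langlands.Cruxes.ReciprocityUpToIrreducibility.AbelianThreefoldPotentialAutomorphy

/-! ## 1. Vocabulary: framed duals of Tate modules, potential automorphy, the family -/

/-- `r` is the framed dual of `V_ℓ(A)` in the dual basis of `b` (verbatim the clause of the BCGP / FLS facts):
`r(γ) = [γ⁻¹]_bᵀ`, i.e. `H¹_ét(A_{K̄}, ℚ_ℓ) ⊗ ℚ̄_ℓ` framed. -/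
def IsFramedDualTate {K : Type} [Field K] [NumberField K] (A : AbelianVariety K) (ℓ : ℕ) [Fact ℓ.Prime]
    {m : ℕ} (b : Module.Basis (Fin m) ℚ_[ℓ] (A.rationalTateModule ℓ))
    (r : FramedGaloisRep K (PadicAlgCl ℓ) m) : Prop :=
  ∀ g : Field.absoluteGaloisGroup K,
    (r g).val = ((LinearMap.toMatrix b b (A.rationalTateRep ℓ g⁻¹)).map (algebraMap ℚ_[ℓ] (PadicAlgCl ℓ))).transpose

/-- **`r` is potentially automorphic (via `ι`)** — BCGP 2021, Def. 9.1.1 and §9.1 ("there is a finite extension of number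
fields `L/K` such that `𝓡|_{G_L}` is automorphic"; Galois in Thm. 1.1.3), read in the summit's almost-everywhere vocabulary:
there are a finite Galois extension `L/K`, the compactness input for `GL_m` over `L`, and an `L`-algebraic AUTOMORPHIC (not
asserted cuspidal: an isobaric sum is allowed, as in print) representation `P` of `GL_m(𝔸_L)` that is Satake–Frobenius
compatible with `r|_{Γ_L}` (`FramedGaloisRep.restrictField`) at all but finitely many places of `L`. -/
def IsPotentiallyAutomorphic (K : Type) [Field K] [NumberField K] (ℓ : ℕ) [Fact ℓ.Prime] {m : ℕ}
    (ι : PadicAlgCl ℓ ≃+* ℂ) (r : FramedGaloisRep K (PadicAlgCl ℓ) m) : Prop :=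
  ∃ (L : Type) (_ : Field L) (_ : NumberField L) (_ : Algebra K L) (_ : IsGalois K L)
    (hcpt : isCompact_glFiniteIntegralLevel m L) (P : AutomorphicRepData (AutomorphyDatum.gl m L hcpt)),
    P.IsLAlgebraic ∧ ∀ᶠ w : HeightOneSpectrum (𝓞 L) in cofinite, SatakeFrobCompatibleAt ι P (r.restrictField L) w

/-- **THE RUNG FAMILY, dial = the dimension `g = dim A`.**  For every totally real `K`, every abelian variety `A/K` of
dimension `g`, every prime `ℓ`, every framed dual `r : Γ_K → GL_{2g}(ℚ̄_ℓ)` of `V_ℓ(A)` which is irreducible, a.e. unramified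
and de Rham above `ℓ` (Fontaine's pinned datum `fontainePstAdicCompletion`), and every `ι`: `r` is potentially automorphic. -/
def PotentiallyAutomorphicAbelianVarietyTR (g : ℕ) : Prop :=
  ∀ (K : Type) [Field K] [NumberField K] [IsTotallyReal K] (A : AbelianVariety K), A.dim = g →
    ∀ (ℓ : ℕ) [Fact ℓ.Prime] (b : Module.Basis (Fin (2 * g)) ℚ_[ℓ] (A.rationalTateModule ℓ))
      (r : FramedGaloisRep K (PadicAlgCl ℓ) (2 * g)), IsFramedDualTate A ℓ b r →
      r.toGaloisRep.IsIrreducible →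
      (∀ᶠ v : HeightOneSpectrum (𝓞 K) in cofinite, r.IsUnramifiedAt v) →
      (∀ (w : HeightOneSpectrum (𝓞 K)) (hw : ((ℓ : ℕ) : 𝓞 K) ∈ w.asIdeal),
          (fontainePstAdicCompletion w ℓ hw).IsDeRhamFramed (r.toLocal w)) →
      ∀ ι : PadicAlgCl ℓ ≃+* ℂ, IsPotentiallyAutomorphic K ℓ ι r

/-- **THE RUNG (θ31 = 3)**: abelian THREEFOLDS over totally real fields are potentially automorphic. -/
-- @[stub "AbelianThreefoldPotentialAutomorphy"]
def AbelianThreefoldPotentialAutomorphy : Prop := PotentiallyAutomorphicAbelianVarietyTR 3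

/-- **Above the rung (θ31 ≥ 4)**: abelian varieties of every dimension `≥ 4` over totally real fields. -/
-- @[stub "AbelianThreefoldPotentialAutomorphy"]
def HigherGenusPotentialAutomorphy : Prop := ∀ g : ℕ, 4 ≤ g → PotentiallyAutomorphicAbelianVarietyTR g

/-- **Floor text** (obligation node): the member `g = 2` as printed — Boxer–Calegari–Gee–Pilloni 2021, Thm. 1.1.3, in
abelian-variety / `GL₄` a.e.-Satake form; this is VERBATIM the body of the named fact
`Literature.NumberTheory.Automorphic.bcgp2021_potentiallyAutomorphic_abelianSurface` (p214362, vendored by this unit; in print,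
XL to discharge in the tree). [cite: BoxerEtAl2021, Thm. 1.1.3] -/
-- @[stub "AbelianThreefoldPotentialAutomorphy"]
def FloorText : Prop :=
  ∀ (F : Type) [Field F] [NumberField F] [IsTotallyReal F] (A : AbelianVariety F), A.dim = 2 →
    ∀ (ℓ : ℕ) [Fact ℓ.Prime] (b : Module.Basis (Fin 4) ℚ_[ℓ] (A.rationalTateModule ℓ))
      (r : FramedGaloisRep F (PadicAlgCl ℓ) 4),
      (∀ g : Field.absoluteGaloisGroup F,
        (r g).val =
          ((LinearMap.toMatrix b b (A.rationalTateRep ℓ g⁻¹)).map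
            (algebraMap ℚ_[ℓ] (PadicAlgCl ℓ))).transpose) →
      ∀ (ι : PadicAlgCl ℓ ≃+* ℂ),
        ∃ (L : Type) (_ : Field L) (_ : NumberField L) (_ : Algebra F L) (_ : IsGalois F L)
          (hcpt : isCompact_glFiniteIntegralLevel 4 L) (P : AutomorphicRepData (AutomorphyDatum.gl 4 L hcpt)),
          P.IsLAlgebraic ∧
            ∀ᶠ w : HeightOneSpectrum (𝓞 L) in Filter.cofinite, ∃ a : Multiset ℂ,
              P.HasSatakeParamAt w a ∧ (r.restrictField L).IsUnramifiedAt w ∧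
                (r.restrictField L).HasFrobCharpolyAt w (arithFrobPolyOfSatake ι w.residueCard 1 a)

/-! ## 2. The floor `g = 2` from the fact; the family from its members (sorry-free) -/

/-- **F3: the family at `g = 2` from the floor fact** (BCGP 2021 Thm. 1.1.3, AV form): the irreducibility, ramification and
de Rham hypotheses of the member are simply not used; the conclusions agree definitionally. -/
theorem floor_two (h : FloorText) : PotentiallyAutomorphicAbelianVarietyTR 2 := by
  intro K _ _ _ A hdim ℓ _ b r hfr _hirr _hunr _hdR ι
  obtain ⟨L, _, _, _, _, hcpt, P, hL, hsat⟩ := h K A hdim ℓ b r hfr ι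
  exact ⟨L, inferInstance, inferInstance, inferInstance, inferInstance, hcpt, P, hL, hsat⟩

/-- **Every member `g ≥ 2`** from the floor fact, the rung and the higher members (`g = 0` has no content and `g = 1` —
potential modularity of elliptic curves over totally real fields, Taylor — is not on this ladder's books: the merge
quantifies over `2 ≤ g`). -/
theorem family_of (h2 : FloorText) (h3 : AbelianThreefoldPotentialAutomorphy) (h4 : HigherGenusPotentialAutomorphy)
    (g : ℕ) (hg : 2 ≤ g) : PotentiallyAutomorphicAbelianVarietyTR g := by
  rcases Nat.lt_or_ge g 4 with h | h
  · interval_cases g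
    · exact floor_two h2
    · exact h3
  · exact h4 g h

/-! ## 3. The sector of clause (B), the merge target, the off-sector complement -/

/-- **The abelian-variety / totally-real sector of clause (B)** at `(K, ℓ, n, ρ)`: `K` totally real and `ρ` itself a framed
dual of `V_ℓ(A)` for an abelian variety `A/K` of dimension `g ≥ 2` with `n = 2g`. -/
def InAbelianVarietyTRSector (K : Type) [Field K] [NumberField K] (ℓ : ℕ) [Fact ℓ.Prime] {n : ℕ}
    (ρ : FramedGaloisRep K (PadicAlgCl ℓ) n) : Prop :=
  IsTotallyReal K ∧ ∃ (A : AbelianVariety K) (b : Module.Basis (Fin n) ℚ_[ℓ] (A.rationalTateModule ℓ)),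
    2 ≤ A.dim ∧ n = 2 * A.dim ∧ IsFramedDualTate A ℓ b ρ

/-- **Merge target**: clause (B) of E VERBATIM (cuspidal, `L`-algebraic, `Corresponds Rec ι π ρ`) for EVERY reciprocity
datum `Rec`, on the abelian-variety / totally-real sector. -/
def SectorGaloisToAutomorphic : Prop :=
  ∀ (F : Type) [Field F] [NumberField F] (Rec : ReciprocityData F) (n : ℕ), 0 < n →
    ∀ (hcpt : isCompact_glFiniteIntegralLevel n F) (ℓ : ℕ) [Fact ℓ.Prime] (ι : PadicAlgCl ℓ ≃+* ℂ)
      (ρ : FramedGaloisRep F (PadicAlgCl ℓ) n),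
      ρ.toGaloisRep.IsIrreducible → IsGeometricFramed Rec ρ → InAbelianVarietyTRSector F ℓ ρ →
        ∃ π : CuspidalAutomorphicRepData n F hcpt, π.1.IsLAlgebraic ∧ Corresponds Rec ι π.1 ρ

/-- **The off-sector complement**: E with clause (A) entire and clause (B) restricted OFF the sector. -/
-- @[stub "AbelianThreefoldPotentialAutomorphy"]
def OffSectorReciprocity : Prop :=
  ∀ (F : Type) [Field F] [NumberField F], ∃ Rec : ReciprocityData F, ∀ n : ℕ, 0 < n →
    ∀ hcpt : isCompact_glFiniteIntegralLevel n F,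
      (∀ π : CuspidalAutomorphicRepData n F hcpt, π.1.IsLAlgebraic →
        ∀ (ℓ : ℕ) [Fact ℓ.Prime] (ι : PadicAlgCl ℓ ≃+* ℂ),
          ∃ ρ : FramedGaloisRep F (PadicAlgCl ℓ) n, IsGeometricFramed Rec ρ ∧ Corresponds Rec ι π.1 ρ) ∧
      (∀ (ℓ : ℕ) [Fact ℓ.Prime] (ι : PadicAlgCl ℓ ≃+* ℂ) (ρ : FramedGaloisRep F (PadicAlgCl ℓ) n),
        ρ.toGaloisRep.IsIrreducible → IsGeometricFramed Rec ρ → ¬ InAbelianVarietyTRSector F ℓ ρ →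
          ∃ π : CuspidalAutomorphicRepData n F hcpt, π.1.IsLAlgebraic ∧ Corresponds Rec ι π.1 ρ)

/-- **Sector-merge step** (obligation node): from POTENTIAL automorphy of every member of the family (`g ≥ 2`) to clause
(B) of E verbatim on the sector, for every reciprocity datum `Rec` — Galois descent of automorphy along `L/K` (solvable
base change where it applies, Brauer induction does NOT suffice for automorphy), cuspidality of the descended `π` from the
irreducibility of `ρ` (Jacquet–Shalika), and local–global compatibility at every place for `Rec`. -/
-- @[stub "AbelianThreefoldPotentialAutomorphy"]
def SectorMergeStep : Prop :=
  (∀ g : ℕ, 2 ≤ g → PotentiallyAutomorphicAbelianVarietyTR g) → SectorGaloisToAutomorphic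

/-! ## 4. The five registered stubs -/

/-- The FLOOR as printed: BCGP 2021 Thm. 1.1.3 in AV form (in print; XL to discharge; = the named fact, p214362). -/
theorem stub_floorFact : FloorText := by
  sorry

/-- **THE RUNG (open core)**: abelian threefolds over totally real fields are potentially automorphic. -/
theorem stub_rung : AbelianThreefoldPotentialAutomorphy := by
  sorry

/-- The members above the rung (`g ≥ 4`). -/
theorem stub_higher : HigherGenusPotentialAutomorphy := by
  sorry

/-- Sector merge: from potential automorphy of every member to clause (B) of E verbatim on the sector, for every `Rec`
(descent along `L/K`, cuspidality from irreducibility, local–global compatibility). -/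
theorem stub_sectorMerge : SectorMergeStep := by
  sorry

/-- E with clause (B) restricted OFF the sector (the honest complement). -/
theorem stub_offSector : OffSectorReciprocity := by
  sorry

/-! ## 5. Composition (no sorry below this line) -/

/-- **SKELETON THEOREM — the crux BY NAME from the five REGISTERED stubs, used by name** (audit: proof-of-item modulo the
five sorries; this is the theorem `ledger skeleton check` registers).  `Rec` and clause (A) come from the off-sector stub;
clause (B) is a case split on the sector `InAbelianVarietyTRSector`. -/
theorem reciprocityUpToIrreducibility_of_stubs :
    Summit.Langlands.Langlands.Theses.OrdinaryPrimeTransport.ReciprocityUpToIrreducibility := by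
  intro F _ _
  obtain ⟨Rec, hall⟩ := stub_offSector F
  refine ⟨Rec, fun n hn hcpt => ⟨(hall n hn hcpt).1, ?_⟩⟩
  intro ℓ _ ι ρ hirr hgeo
  by_cases hsec : InAbelianVarietyTRSector F ℓ ρ
  · exact stub_sectorMerge (family_of stub_floorFact stub_rung stub_higher) F Rec n hn hcpt ℓ ι ρ hirr hgeo hsec
  · exact (hall n hn hcpt).2 ℓ ι ρ hirr hgeo hsec

/-- **COMPOSITION, hypothesis form — the crux BY NAME from the five stub STATEMENTS** (sorry-free; the same eight lines
with the stubs as hypotheses, for provers who close the stubs elsewhere). -/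
theorem ReciprocityUpToIrreducibility_of :
    FloorText → AbelianThreefoldPotentialAutomorphy → HigherGenusPotentialAutomorphy → SectorMergeStep →
    OffSectorReciprocity →
    Summit.Langlands.Langlands.Theses.OrdinaryPrimeTransport.ReciprocityUpToIrreducibility := by
  intro h2 h3 h4 hmerge hoff F _ _
  obtain ⟨Rec, hall⟩ := hoff F
  refine ⟨Rec, fun n hn hcpt => ⟨(hall n hn hcpt).1, ?_⟩⟩
  intro ℓ _ ι ρ hirr hgeo
  by_cases hsec : InAbelianVarietyTRSector F ℓ ρ
  · exact hmerge (family_of h2 h3 h4) F Rec n hn hcpt ℓ ι ρ hirr hgeo hsec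
  · exact (hall n hn hcpt).2 ℓ ι ρ hirr hgeo hsec

/-! ## 6. The rung is a consequence of the top and of the summit (sorry-free) -/

/-- `E → PotentiallyAutomorphicAbelianVarietyTR g` for every `g ≥ 1` (witness `L := K`: clause (B) at `n = 2g` gives a
cuspidal `L`-algebraic `π` with `Corresponds Rec ι π.1 r`, whose first conjunct is the a.e. Satake clause; restriction along the
identity is a change of frame, `Theorems.ReciprocityTRCM.satakeFrobCompatibleAt_restrictField_self`). -/
theorem potAut_of_top (g : ℕ) (hg : 1 ≤ g)
    (hE : Summit.Langlands.Langlands.Theses.OrdinaryPrimeTransport.ReciprocityUpToIrreducibility) :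
    PotentiallyAutomorphicAbelianVarietyTR g := by
  intro K _ _ _ A _hdim ℓ _ b r _hfr hirr hunr hdR ι
  obtain ⟨Rec, hall⟩ := hE K
  have hcpt : isCompact_glFiniteIntegralLevel (2 * g) K := isCompact_glFiniteIntegralLevel_holds (2 * g) K
  have hB : GaloisToAutomorphic (2 * g) Rec hcpt := (hall (2 * g) (by omega) hcpt).2
  have hgeo : IsGeometricFramed Rec r := ⟨hunr, fun w hw => hdR w hw⟩
  obtain ⟨π, hLalg, hcorr⟩ := hB ℓ ι r hirr hgeo
  exact ⟨K, inferInstance, inferInstance, inferInstance, IsGalois.self K, hcpt, π.1, hLalg,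
    hcorr.1.mono fun _ hv => Theorems.ReciprocityTRCM.satakeFrobCompatibleAt_restrictField_self ι π.1 hv⟩

/-- `E → rung`. -/
theorem AbelianThreefoldPotentialAutomorphy_of_top
    (hE : Summit.Langlands.Langlands.Theses.OrdinaryPrimeTransport.ReciprocityUpToIrreducibility) :
    AbelianThreefoldPotentialAutomorphy :=
  potAut_of_top 3 (by norm_num) hE

/-- `Langlands → PotentiallyAutomorphicAbelianVarietyTR g` for every `g ≥ 1` (the F4 on-path lemma). -/
theorem potAut_of_langlands (g : ℕ) (hg : 1 ≤ g) (hL : _root_.Langlands) :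
    PotentiallyAutomorphicAbelianVarietyTR g := by
  intro K _ _ _ A _hdim ℓ _ b r _hfr hirr hunr hdR ι
  obtain ⟨⟨Rec⟩, hall⟩ := hL K
  have hcpt : isCompact_glFiniteIntegralLevel (2 * g) K := isCompact_glFiniteIntegralLevel_holds (2 * g) K
  have hB : GaloisToAutomorphic (2 * g) Rec hcpt := (hall Rec (2 * g) (by omega) hcpt).2
  have hgeo : IsGeometricFramed Rec r := ⟨hunr, fun w hw => hdR w hw⟩
  obtain ⟨π, hLalg, hcorr⟩ := hB ℓ ι r hirr hgeo
  exact ⟨K, inferInstance, inferInstance, inferInstance, IsGalois.self K, hcpt, π.1, hLalg,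
    hcorr.1.mono fun _ hv => Theorems.ReciprocityTRCM.satakeFrobCompatibleAt_restrictField_self ι π.1 hv⟩

/-- **F4 on-path lemma**: `S → Rung`. -/
@[aesop safe apply]
theorem AbelianThreefoldPotentialAutomorphy_of_Langlands (hL : _root_.Langlands) : AbelianThreefoldPotentialAutomorphy :=
  potAut_of_langlands 3 (by norm_num) hL

end Summit.Langlands.Langlands.Cruxes.ReciprocityUpToIrreducibility.AbelianThreefoldPotentialAutomorphy

end
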